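import Literature.NumberTheory.Automorphic.ArchHeckeTestVectorGammaGL2
import HarnessLib

/-!
# Unitarity bounds on the real-place parameters of `GL₂(K_∞)`: no complementary series beyond `½`
# (Knapp (1986), Ch. XVI §1; Jacquet–Langlands (1970), §5 Thm. 5.13 and Lemma 5.6.1)

Topic `NumberTheory/Automorphic`; namespace `Literature.NumberTheory.Automorphic`. Theorems only (no
definition, no named fact, no instance). In the tree's classification-free Kirillov theory of `GL₂(K_∞)`
(`ArchKirillovShapeTypesGL2`, `ArchHeckeTestVectorConstructionGL2`) the Bessel parameter `ν_w` of a
weight-zero vector at a real place `w` is ANY complex number with `λ = μ²/2 - 2ν² - ½` (`λ` the Casimir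
eigenvalue, `μ` the central scalar; the Kirillov function is then `c u^{μ/2} · 2√u K_{iν}(2πu)`): the Hecke
theory needed only SOME right half-plane of convergence. The Rankin–Selberg theory
(`HumphriesJo2024_archRankinSelberg_testVector`: identities on ALL of `re s > 1`, shifts of real part `> -1`)
needs the UNITARITY BOUNDS, proved here from the skew-symmetry of `τ(X)` on the Gårding space of a unitary
representation (`inner_gardingEnd_eq_neg`) and the identities `L R v = R L v = (2λ - μ²) v` on weight-zero
vectors (`raising_lowering_apply`, `lowering_raising_apply`):

* `re_eq_zero_of_gardingEnd_eq_smul` — an eigenvalue of `τ(X)` (`X ∈ 𝔤𝔩₂(K_∞)` real) on a non-zero Gårding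
  vector is purely imaginary; in particular the central scalar `μ_w` is (`re μ_w = 0`);
* `im_eq_zero_of_casimir_eq_smul` — a Casimir eigenvalue `λ_w` is real;
* `inner_raising_self`, `two_mul_casimir_sub_sq_nonpos` — for a weight-zero vector
  `‖R v‖² = -(2λ - μ²) ‖v‖²`, so `2λ - μ²` is real `≤ 0`, and `< 0` as soon as `R v ≠ 0` or `L v ≠ 0`;
* `two_mul_casimir_sub_sq_ne_zero` — for `τ` irreducible unitary with a non-zero continuous Whittaker
  functional and `v` weight-zero, `K_∞`-finite, non-zero: `2λ - μ² ≠ 0` (if `R v = L v = 0` then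
  `τ(X⁺_w) v = 0`, so the Kirillov function of `v` vanishes, `kirillovFn_gardingEnd_realIdem`, contradicting
  `not_mem_kirillovNull_of_mem_archKFinite`);
* `abs_im_besselParam_le_half`, `abs_im_besselParam_lt_half` (**main**) — with `λ = μ²/2 - 2ν² - ½`:
  `ν²` is real `≥ -¼`, hence `|im ν| ≤ ½`, and `|im ν| < ½` in the generic case — the classical statement
  that the complementary series of `GL₂(ℝ)` have parameter `< ½` (Knapp, Thm. 16.2; Jacquet–Langlands,
  Lemma 5.6.1 / Thm. 5.13 (iii)).

## References

* A. W. Knapp, *Representation Theory of Semisimple Groups* (1986), Ch. III §3, Ch. XVI §1 Thm. 16.2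
  [Knapp1986].
* H. Jacquet, R. P. Langlands, *Automorphic Forms on GL(2)*, LNM 114 (1970), §5 (Lemma 5.6.1, Thm. 5.13)
  [JacquetLanglands1970].
* D. Bump, *Automorphic Forms and Representations* (1997), §2.2, §2.6 [Bump1997].
-/

noncomputable section

open MeasureTheory Measure NumberField NumberField.InfinitePlace NumberField.mixedEmbedding IsDedekindDomain Set Filter
open scoped MatrixGroups Topology Classical InnerProductSpace ComplexConjugate

namespace Literature.NumberTheory.Automorphic

variable {K : Type} [Field K] [NumberField K]

-- as in `ArchGardingWhittaker`
set_option backward.isDefEq.respectTransparency false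

/-! ### 1. Eigenvalues of skew-symmetric operators -/

section Skew

variable {n : ℕ} {hcpt : isCompact_glFiniteIntegralLevel n K}
  {E : Type*} [NormedAddCommGroup E] [InnerProductSpace ℂ E] [CompleteSpace E]
  {τ : ContRepresentation ℂ (AutomorphyDatum.gl n K hcpt).arch.carrier E}
  (hτ : τ.IsStronglyContinuous)

/-- **An eigenvalue of `τ(X)` on a non-zero Gårding vector of a unitary representation is purely imaginary**
(`τ(X)` is skew-symmetric on the Gårding space). [cite: Knapp1986, Ch. III §3] -/
theorem re_eq_zero_of_gardingEnd_eq_smul (hτu : τ.IsUnitary) (X : Matrix (Fin n) (Fin n) (mixedSpace K))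
    {v : archGardingSpace hcpt τ} (hv0 : v ≠ 0) {μ : ℂ} (h : gardingEnd hτ X v = μ • v) : μ.re = 0 := by
  have hskew := inner_gardingEnd_eq_neg hτ hτu X v v
  rw [h, Submodule.coe_smul, inner_smul_left, inner_smul_right] at hskew
  have hvv : ⟪(v : E), (v : E)⟫_ℂ ≠ 0 := by
    rw [inner_self_ne_zero]
    exact fun h0 => hv0 (Subtype.ext h0)
  have hconj : conj μ = -μ := by
    have := mul_right_cancel₀ hvv (hskew.trans (neg_mul μ _).symm)
    exact this
  have hre := congrArg Complex.re hconj
  rw [Complex.conj_re, Complex.neg_re] at hre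
  linarith

end Skew

/-! ### 2. Real places: the Casimir is symmetric, `‖R v‖² = -(2λ - μ²)‖v‖²` -/

section RealPlace

variable {hcpt : isCompact_glFiniteIntegralLevel 2 K}
  {E : Type*} [NormedAddCommGroup E] [InnerProductSpace ℂ E] [CompleteSpace E]
  {τ : ContRepresentation ℂ (AutomorphyDatum.gl 2 K hcpt).arch.carrier E}
  (hτ : τ.IsStronglyContinuous) (w : {w : InfinitePlace K // IsReal w})

local notation "H₀" => Matrix.single (0 : Fin 2) (0 : Fin 2) ((Pi.single w 1, 0) : mixedSpace K)
local notation "H₁" => Matrix.single (1 : Fin 2) (1 : Fin 2) ((Pi.single w 1, 0) : mixedSpace K)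
local notation "X⁺" => Matrix.single (0 : Fin 2) (1 : Fin 2) ((Pi.single w 1, 0) : mixedSpace K)
local notation "X⁻" => Matrix.single (1 : Fin 2) (0 : Fin 2) ((Pi.single w 1, 0) : mixedSpace K)
local notation "D" => gardingEnd (hcpt := hcpt) (τ := τ) hτ
local notation "Lo" => (gardingEnd (hcpt := hcpt) (τ := τ) hτ (H₀ - H₁) - Complex.I • gardingEnd (hcpt := hcpt) (τ := τ) hτ (X⁺ + X⁻))
local notation "Ra" => (gardingEnd (hcpt := hcpt) (τ := τ) hτ (H₀ - H₁) + Complex.I • gardingEnd (hcpt := hcpt) (τ := τ) hτ (X⁺ + X⁻))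
local notation "Cas" v:max => (∑ i : Fin 2, ∑ j : Fin 2, gardingEnd (hcpt := hcpt) (τ := τ) hτ (Matrix.single i j ((Pi.single w 1, 0) : mixedSpace K))
  (gardingEnd (hcpt := hcpt) (τ := τ) hτ (Matrix.single j i ((Pi.single w 1, 0) : mixedSpace K)) v))

/-- **The place-`w` Casimir is symmetric on the Gårding space of a unitary representation**:
`⟪C_w v, v'⟫ = ⟪v, C_w v'⟫`. [cite: Knapp1986, Ch. VIII §3] -/
theorem inner_casimir_left_eq_right (hτu : τ.IsUnitary) (v v' : archGardingSpace hcpt τ) :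
    ⟪((Cas v : archGardingSpace hcpt τ) : E), (v' : E)⟫_ℂ = ⟪(v : E), ((Cas v' : archGardingSpace hcpt τ) : E)⟫_ℂ := by
  simp only [AddSubmonoidClass.coe_finsetSum, sum_inner, inner_sum]
  rw [Finset.sum_comm]
  refine Finset.sum_congr rfl fun i _ => Finset.sum_congr rfl fun j _ => ?_
  rw [inner_gardingEnd_eq_neg hτ hτu, inner_gardingEnd_eq_neg hτ hτu, neg_neg]

/-- **A Casimir eigenvalue on a non-zero Gårding vector of a unitary representation is real.** [cite: Knapp1986, Ch. VIII §3] -/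
theorem im_eq_zero_of_casimir_eq_smul (hτu : τ.IsUnitary) {v : archGardingSpace hcpt τ} (hv0 : v ≠ 0) {lam : ℂ}
    (hC : Cas v = lam • v) : lam.im = 0 := by
  have h := inner_casimir_left_eq_right hτ w hτu v v
  rw [hC, Submodule.coe_smul, inner_smul_left, inner_smul_right] at h
  have hvv : ⟪(v : E), (v : E)⟫_ℂ ≠ 0 := by
    rw [inner_self_ne_zero]
    exact fun h0 => hv0 (Subtype.ext h0)
  have hconj : conj lam = lam := mul_right_cancel₀ hvv h
  have him := congrArg Complex.im hconj
  rw [Complex.conj_im] at him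
  linarith

/-- **`⟪R v, R v⟫ = -(2λ - μ²) ⟪v, v⟫` for a weight-zero vector** (`R* = -L` by skew-symmetry and
`L R v = (2λ - μ²) v`). [cite: Knapp1986, Ch. XVI §1] -/
theorem inner_raising_self (hτu : τ.IsUnitary) (μ lam : ℂ) (v : archGardingSpace hcpt τ)
    (hW : D (X⁺ - X⁻) v = 0) (hZ : D H₀ v + D H₁ v = μ • v) (hC : Cas v = lam • v) :
    ⟪((Ra v : archGardingSpace hcpt τ) : E), ((Ra v : archGardingSpace hcpt τ) : E)⟫_ℂ =
      -(2 * lam - μ ^ 2) * ⟪(v : E), (v : E)⟫_ℂ := by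
  have hW0 : D (X⁺ - X⁻) v = (Complex.I * 0) • v := by rw [hW, mul_zero, zero_smul]
  have hLR : Lo (Ra v) = (2 * lam - μ ^ 2) • v := by
    rw [lowering_raising_apply hτ w 0 μ lam v hW0 hZ hC]
    congr 1
    ring
  have hcoe : ((Ra v : archGardingSpace hcpt τ) : E) =
      ((D (H₀ - H₁) v : archGardingSpace hcpt τ) : E) + Complex.I • ((D (X⁺ + X⁻) v : archGardingSpace hcpt τ) : E) := by
    rw [LinearMap.add_apply, LinearMap.smul_apply, Submodule.coe_add, Submodule.coe_smul]
  have hLo : ((Lo (Ra v) : archGardingSpace hcpt τ) : E) =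
      ((D (H₀ - H₁) (Ra v) : archGardingSpace hcpt τ) : E) - Complex.I • ((D (X⁺ + X⁻) (Ra v) : archGardingSpace hcpt τ) : E) := by
    rw [LinearMap.sub_apply, LinearMap.smul_apply, Submodule.coe_sub, Submodule.coe_smul]
  have h1 := inner_gardingEnd_eq_neg hτ hτu (H₀ - H₁) v (Ra v)
  have h2 := inner_gardingEnd_eq_neg hτ hτu (X⁺ + X⁻) v (Ra v)
  have key : ⟪(v : E), ((Lo (Ra v) : archGardingSpace hcpt τ) : E)⟫_ℂ = (2 * lam - μ ^ 2) * ⟪(v : E), (v : E)⟫_ℂ := by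
    rw [hLR, Submodule.coe_smul, inner_smul_right]
  have e1 : ⟪((Ra v : archGardingSpace hcpt τ) : E), ((Ra v : archGardingSpace hcpt τ) : E)⟫_ℂ =
      ⟪((D (H₀ - H₁) v : archGardingSpace hcpt τ) : E) + Complex.I • ((D (X⁺ + X⁻) v : archGardingSpace hcpt τ) : E),
        ((Ra v : archGardingSpace hcpt τ) : E)⟫_ℂ := congrArg (fun x : E => ⟪x, ((Ra v : archGardingSpace hcpt τ) : E)⟫_ℂ) hcoe
  rw [e1, inner_add_left, inner_smul_left, h1, h2, Complex.conj_I]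
  rw [hLo, inner_sub_right, inner_smul_right] at key
  linear_combination -key

/-- **`2λ - μ²` is real `≤ 0` on a non-zero weight-zero vector of a unitary representation**, and `< 0`
unless `R v = 0`. [cite: Knapp1986, Ch. XVI §1, Thm. 16.2] -/
theorem two_mul_casimir_sub_sq_nonpos (hτu : τ.IsUnitary) (μ lam : ℂ) {v : archGardingSpace hcpt τ} (hv0 : v ≠ 0)
    (hW : D (X⁺ - X⁻) v = 0) (hZ : D H₀ v + D H₁ v = μ • v) (hC : Cas v = lam • v) :
    (2 * lam - μ ^ 2).im = 0 ∧ (2 * lam - μ ^ 2).re ≤ 0 ∧ (Ra v ≠ 0 → (2 * lam - μ ^ 2).re < 0) := by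
  have h := inner_raising_self hτ w hτu μ lam v hW hZ hC
  have hnormsq : ∀ x : E, ⟪x, x⟫_ℂ = ((‖x‖ ^ 2 : ℝ) : ℂ) := fun x => by
    rw [inner_self_eq_norm_sq_to_K]; norm_cast
  rw [hnormsq, hnormsq] at h
  have hvE : (v : E) ≠ 0 := fun h0 => hv0 (Subtype.ext h0)
  have hv : (0 : ℝ) < ‖(v : E)‖ ^ 2 := by positivity
  -- `2λ - μ² = -‖R v‖² / ‖v‖²`
  have hv' : ((‖(v : E)‖ ^ 2 : ℝ) : ℂ) ≠ 0 := Complex.ofReal_ne_zero.mpr hv.ne'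
  have hq0 : 2 * lam - μ ^ 2 = -(((‖((Ra v : archGardingSpace hcpt τ) : E)‖ ^ 2 : ℝ) : ℂ) / ((‖(v : E)‖ ^ 2 : ℝ) : ℂ)) := by
    have e : ((‖((Ra v : archGardingSpace hcpt τ) : E)‖ ^ 2 : ℝ) : ℂ) / ((‖(v : E)‖ ^ 2 : ℝ) : ℂ) = -(2 * lam - μ ^ 2) := by
      rw [div_eq_iff hv', h]
    rw [e, neg_neg]
  have hq : 2 * lam - μ ^ 2 = ((-(‖((Ra v : archGardingSpace hcpt τ) : E)‖ ^ 2 / ‖(v : E)‖ ^ 2) : ℝ) : ℂ) := by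
    rw [hq0]
    push_cast
    ring
  refine ⟨?_, ?_, fun hR => ?_⟩
  · rw [hq, Complex.ofReal_im]
  · rw [hq, Complex.ofReal_re, neg_nonpos]
    positivity
  · rw [hq, Complex.ofReal_re, neg_lt_zero]
    have hR' : ((Ra v : archGardingSpace hcpt τ) : E) ≠ 0 := fun h0 => hR (Subtype.ext h0)
    positivity

/-- **Genericity: `2λ - μ² ≠ 0`** for a non-zero `K_∞`-finite weight-zero vector of an irreducible unitary
`τ` with a non-zero continuous Whittaker functional: otherwise `R v = L v = 0`, so `τ(X⁺_w) v = 0` and the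
Kirillov function of `v` vanishes identically. [cite: JacquetLanglands1970, §5 Lemma 5.6.1 and Thm. 5.13] -/
theorem two_mul_casimir_sub_sq_ne_zero (hτu : τ.IsUnitary) (hτi : τ.IsTopIrreducible)
    {ℓ : archGardingSpace hcpt τ →ₗ[ℂ] ℂ} (hℓW : IsArchContWhittakerFunctional hcpt τ hτ ℓ) (hne : ℓ ≠ 0)
    (μ lam : ℂ) {v : archGardingSpace hcpt τ} (hvK : v ∈ archKFinite hτ) (hv0 : v ≠ 0)
    (hW : D (X⁺ - X⁻) v = 0) (hZ : D H₀ v + D H₁ v = μ • v) (hC : Cas v = lam • v) :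
    2 * lam - μ ^ 2 ≠ 0 := by
  intro h0
  have hW0 : D (X⁺ - X⁻) v = (Complex.I * 0) • v := by rw [hW, mul_zero, zero_smul]
  -- `‖R v‖² = 0` and `‖L v‖² = 0`
  have hR : Ra v = 0 := by
    have h := inner_raising_self hτ w hτu μ lam v hW hZ hC
    rw [h0, neg_zero, zero_mul, inner_self_eq_zero] at h
    exact Subtype.ext h
  have hL : Lo v = 0 := by
    -- `⟪L v, L v⟫ = -⟪v, R L v⟫ = -(2λ - μ²) ‖v‖² = 0`
    have hRL : Ra (Lo v) = (2 * lam - μ ^ 2) • v := by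
      rw [raising_lowering_apply hτ w 0 μ lam v hW0 hZ hC]
      congr 1
      ring
    have hcoe : ((Lo v : archGardingSpace hcpt τ) : E) =
        ((D (H₀ - H₁) v : archGardingSpace hcpt τ) : E) - Complex.I • ((D (X⁺ + X⁻) v : archGardingSpace hcpt τ) : E) := by
      rw [LinearMap.sub_apply, LinearMap.smul_apply, Submodule.coe_sub, Submodule.coe_smul]
    have hRa : ((Ra (Lo v) : archGardingSpace hcpt τ) : E) =
        ((D (H₀ - H₁) (Lo v) : archGardingSpace hcpt τ) : E) + Complex.I • ((D (X⁺ + X⁻) (Lo v) : archGardingSpace hcpt τ) : E) := by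
      rw [LinearMap.add_apply, LinearMap.smul_apply, Submodule.coe_add, Submodule.coe_smul]
    have h1 := inner_gardingEnd_eq_neg hτ hτu (H₀ - H₁) v (Lo v)
    have h2 := inner_gardingEnd_eq_neg hτ hτu (X⁺ + X⁻) v (Lo v)
    have key : ⟪(v : E), ((Ra (Lo v) : archGardingSpace hcpt τ) : E)⟫_ℂ = 0 := by
      rw [hRL, h0, zero_smul, Submodule.coe_zero, inner_zero_right]
    have e1 : ⟪((Lo v : archGardingSpace hcpt τ) : E), ((Lo v : archGardingSpace hcpt τ) : E)⟫_ℂ =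
        ⟪((D (H₀ - H₁) v : archGardingSpace hcpt τ) : E) - Complex.I • ((D (X⁺ + X⁻) v : archGardingSpace hcpt τ) : E),
          ((Lo v : archGardingSpace hcpt τ) : E)⟫_ℂ := congrArg (fun x : E => ⟪x, ((Lo v : archGardingSpace hcpt τ) : E)⟫_ℂ) hcoe
    have hself : ⟪((Lo v : archGardingSpace hcpt τ) : E), ((Lo v : archGardingSpace hcpt τ) : E)⟫_ℂ = 0 := by
      rw [e1, inner_sub_left, inner_smul_left, h1, h2, Complex.conj_I]
      rw [hRa, inner_add_right, inner_smul_right] at key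
      linear_combination -key
    rw [inner_self_eq_zero] at hself
    exact Subtype.ext hself
  -- hence `τ(X⁺) v = 0`
  have hXp : D X⁺ v = 0 := by
    have hA : D (H₀ - H₁) v = 0 := by
      have h2 : (2 : ℂ) • D (H₀ - H₁) v = 0 := by
        have h := congrArg₂ (· + ·) hR hL
        simp only [LinearMap.add_apply, LinearMap.sub_apply, LinearMap.smul_apply, add_zero] at h
        rw [two_smul, ← h]
        abel
      exact (smul_eq_zero.mp h2).resolve_left two_ne_zero
    have hS : D (X⁺ + X⁻) v = 0 := by
      have h := hR
      rw [LinearMap.add_apply, LinearMap.smul_apply, hA, zero_add, smul_eq_zero] at h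
      exact h.resolve_left Complex.I_ne_zero
    have h2 : (2 : ℂ) • D X⁺ v = 0 := by
      rw [gardingEnd_add, LinearMap.add_apply] at hS
      rw [gardingEnd_sub, LinearMap.sub_apply] at hW
      have : D X⁺ v + D X⁺ v = 0 := by
        calc D X⁺ v + D X⁺ v = (D X⁺ v + D X⁻ v) + (D X⁺ v - D X⁻ v) := by abel
          _ = 0 := by rw [hS, hW, add_zero]
      rwa [two_smul]
    exact (smul_eq_zero.mp h2).resolve_left two_ne_zero
  -- so the Kirillov function of `v` vanishes: contradiction
  refine not_mem_kirillovNull_of_mem_archKFinite hτ hτu hτi hℓW hne hvK hv0 fun u => ?_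
  have hk := kirillovFn_gardingEnd_realIdem hτ hℓW w v u
  have hk0 : kirillovFn hτ ℓ (0 : archGardingSpace hcpt τ) u = 0 := by
    rw [← zero_smul ℂ v, kirillovFn_smul, Pi.smul_apply, smul_eq_mul, zero_mul]
  rw [hXp, hk0] at hk
  have hc : ((-(2 * Real.pi) * (u : mixedSpace K).1 w : ℝ) : ℂ) * Complex.I ≠ 0 := by
    refine mul_ne_zero ?_ Complex.I_ne_zero
    exact_mod_cast mul_ne_zero (neg_ne_zero.mpr (by positivity)) (units_fst_ne_zero u w)
  have h := hk.symm
  rw [mul_eq_zero] at h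
  exact h.resolve_left hc

/-! ### 3. The bound on the Bessel parameter -/

/-- **`|im ν| ≤ ½` for the Bessel parameter of a weight-zero vector of a unitary representation**
(`λ = μ²/2 - 2ν² - ½`, so `2λ - μ² = -4ν² - 1 ≤ 0` real: `ν²` is real `≥ -¼`). [cite: Knapp1986, Ch. XVI §1, Thm. 16.2] -/
theorem abs_im_besselParam_le_half (hτu : τ.IsUnitary) (μ lam ν : ℂ) (hlam : lam = μ ^ 2 / 2 - 2 * ν ^ 2 - 1 / 2)
    {v : archGardingSpace hcpt τ} (hv0 : v ≠ 0)
    (hW : D (X⁺ - X⁻) v = 0) (hZ : D H₀ v + D H₁ v = μ • v) (hC : Cas v = lam • v) :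
    |ν.im| ≤ 1 / 2 := by
  obtain ⟨him, hre, -⟩ := two_mul_casimir_sub_sq_nonpos hτ w hτu μ lam hv0 hW hZ hC
  have hq : 2 * lam - μ ^ 2 = -4 * ν ^ 2 - 1 := by rw [hlam]; ring
  rw [hq] at him hre
  simp only [Complex.sub_im, Complex.mul_im, Complex.neg_re, Complex.neg_im, Complex.re_ofNat, Complex.im_ofNat,
    Complex.one_im, sub_zero, neg_zero, zero_mul, add_zero, sq, Complex.mul_re] at him hre
  simp only [Complex.sub_re, Complex.mul_re, Complex.neg_re, Complex.re_ofNat, Complex.neg_im, Complex.im_ofNat,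
    neg_zero, zero_mul, sub_zero, Complex.one_re, Complex.mul_im] at hre
  -- `him : re ν · im ν = 0`, `hre : im ν ² - re ν ² ≤ ¼`
  have h1 : ν.re * ν.im = 0 := by nlinarith
  rcases mul_eq_zero.mp h1 with h | h
  · rw [h] at hre
    rw [abs_le]
    constructor <;> nlinarith
  · rw [h, abs_zero]; norm_num

/-- **`|im ν| < ½` in the generic case** (no complementary series at the endpoint): for `τ` irreducible
unitary with a non-zero continuous Whittaker functional and `v` weight-zero, `K_∞`-finite, non-zero with
`λ = μ²/2 - 2ν² - ½`. [cite: JacquetLanglands1970, §5 Lemma 5.6.1 and Thm. 5.13] [cite: Knapp1986, Ch. XVI §1, Thm. 16.2] -/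
theorem abs_im_besselParam_lt_half (hτu : τ.IsUnitary) (hτi : τ.IsTopIrreducible)
    {ℓ : archGardingSpace hcpt τ →ₗ[ℂ] ℂ} (hℓW : IsArchContWhittakerFunctional hcpt τ hτ ℓ) (hne : ℓ ≠ 0)
    (μ lam ν : ℂ) (hlam : lam = μ ^ 2 / 2 - 2 * ν ^ 2 - 1 / 2)
    {v : archGardingSpace hcpt τ} (hvK : v ∈ archKFinite hτ) (hv0 : v ≠ 0)
    (hW : D (X⁺ - X⁻) v = 0) (hZ : D H₀ v + D H₁ v = μ • v) (hC : Cas v = lam • v) :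
    |ν.im| < 1 / 2 := by
  obtain ⟨him, hre, -⟩ := two_mul_casimir_sub_sq_nonpos hτ w hτu μ lam hv0 hW hZ hC
  have hne0 := two_mul_casimir_sub_sq_ne_zero hτ w hτu hτi hℓW hne μ lam hvK hv0 hW hZ hC
  have hre' : (2 * lam - μ ^ 2).re < 0 := by
    rcases lt_or_eq_of_le hre with h | h
    · exact h
    · exact absurd (Complex.ext (by rw [h, Complex.zero_re]) (by rw [him, Complex.zero_im])) hne0
  have hq : 2 * lam - μ ^ 2 = -4 * ν ^ 2 - 1 := by rw [hlam]; ring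
  rw [hq] at him hre'
  simp only [Complex.sub_im, Complex.mul_im, Complex.neg_re, Complex.neg_im, Complex.re_ofNat, Complex.im_ofNat,
    Complex.one_im, sub_zero, neg_zero, zero_mul, add_zero, sq, Complex.mul_re] at him hre'
  simp only [Complex.sub_re, Complex.mul_re, Complex.neg_re, Complex.re_ofNat, Complex.neg_im, Complex.im_ofNat,
    neg_zero, zero_mul, sub_zero, Complex.one_re, Complex.mul_im] at hre'
  have h1 : ν.re * ν.im = 0 := by nlinarith
  rcases mul_eq_zero.mp h1 with h | h
  · rw [h] at hre'
    rw [abs_lt]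
    constructor <;> nlinarith
  · rw [h, abs_zero]; norm_num

end RealPlace

end Literature.NumberTheory.Automorphic
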